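import Summits.QuantumFields.YangMills.Theorems.UnitScaleTiltProp7SectET3N06LeavesRelZ
import Summits.QuantumFields.YangMills.Theorems.UnitScaleTiltProp7SectET3Floor
import Literature.MathematicalPhysics.QuantumFieldTheory.Balaban1983to89.B9Thm313WholeLeafCompletePairMBZ
import HarnessLib

/-!
# Route `UnitScaleTilt`, crux «MinimiserStabilityRegPr» (stmt-QuantumFields-19200, v10 stub EX, route (α), node N06(d = 3)) — **THE TEXT OF RECORD AT THE T³ INDEX**:
# Track A's leaf of record `B9Thm313WholeLeafCompletePairMBZ.thm313Printed_completePairMBZ` (Theorem 3.13 as the whole printed leaf `B9.Thm313Printed`, residual ABSORBED, Z-classed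
# letters, carrier-relative co-readings) READ AT `KIdx 2 ℓ hd3 hL b₀ b₁ ∕ geo9K ∕ bgT3` through the M-floor junction (OWNER RULING g25-№2: «N06(d = 3) = Track A's leaves
# `thm313Printed_completePairMBZ` ∕ `thm312Printed_completePairMBZ` read at d = 3»)

Cell `ym3-torus` (HUMAN RULING D-0037, YM ladder rung R3 — NOT the Clay problem), width seat ym-ust-20520-w1 g3.  Count-neutral helper (`--supports stmt-QuantumFields-19200 --as
helper`); registry untouched; THEOREMS ONLY (0 `def`, 0 `sorry`); NOTHING of [Balaban1985BackgroundPropagators] is asserted.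

WHY.  The earlier T³ leaves of this seat (`t313_of_pins_T3_coGlob ∕ _relZ`, ✓ p601287 ∕ ✓ p603926) keep a displayed RESIDUAL `hres` ((3.46), (3.43)–(3.45) of 𝔊); the leaf OF RECORD absorbs
it (every member of `B9.Thm313Printed` derived from letters) but carries two floor-dependent geometry binders `hnbr`∕`hCL`.  `Prop7SectET3Floor` (this seat) discharges them above a
floor and lifts `B9.Thm313Printed` from the floor subtype to the whole index; THIS FILE is the port: ★★★ `t313_of_pins_T3_completePairMBZ`.
HONEST SCOPE: a by-name port at d := 2 over the floor subtype `{i // M⋆ ≤ (geo9K i).M}` (`M⋆ := max M_nbr (r+1)`); every analytic row stays a displayed hypothesis (incl. the XL item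
`Thm33G0` and Track A's located `Letters313IMB.locX` defect, displayed as at the record); N06(d = 3) NOT discharged; nothing here claims EX, the crux, V3∕R3, d = 4 or the mass gap.

References: T. Bałaban, CMP **99** (1985) 389–434 [Balaban1985BackgroundPropagators]; CMP **96** (1984) 223–250 [Balaban1984PropagatorsII].
-/

set_option autoImplicit false

noncomputable section

open scoped Matrix.Norms.L2Operator

namespace Summit.QuantumFields.YangMills.Theorems.Prop7SectET3N06LeavesRecord

open Literature.MathematicalPhysics.QuantumFieldTheory.Balaban1983to89
open Finset B6RandomWalk B6RandomWalkHom B9Thm34Ext B9Thm37GlueCor36 B11SectG B9SectDSup B9Thm37AllNorms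
open B9Thm37AllNormsInstances B9FromB6 B9FromB6ModelSignsOn B9SectBStepWhole B9Thm312Whole B9Thm312WholeLeaf B9Thm312WholeLeft B9Thm313Whole
open B9Thm313WholeLeft B9Thm312WholeLeafLeftGlob B9Ineq347CoReading B9SectCDiffDict B9CoRealizesRel B9Thm37Glue B9SectDL2Decay B9RWSums343Holder
open B9RWSumsReadsRel B9RWSumsReadsNbr B9Ineq347 B9Thm312WholeClasses B9Thm312WholeL2 B9Thm312WholeBlocksRel B9Thm312WholeBlocksNbr B9Thm313WholeLeafRel
open B9Thm312WholeHolder B9Thm312WholeHHolder B9Thm313WholeHolder B9Thm313WholeL2G B9Thm313WholeL2GP B9Thm313WholeInput B9Thm313WholeBlocksNbr B9Thm312WholeLeafAll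
open B9RWSums346SecondDiff B9Thm313WholeBlocksNbrRec B9RWSums344InputFam B9Thm312WholeDir B9Thm312WholeBlocksPairM B9Thm313WholeDir B9Thm313WholeDirInput B9Thm313WholeBlocksPairM
open B9Thm313WholeLeafCompletePairM B9Thm312WholeDirB B9Thm313WholeDirInputB B9Thm313WholeBlocksPairMB B9Thm313WholeLeafCompletePairMB B9Thm313WholeBlocksPairMZ B9Thm313WholeBlocksPairMBZ B9Thm313WholeLeafRelZ
open B9Thm312WholeHZ B9Thm313WholeZ B9Thm313WholeLeftZ B9Thm313WholeHolderZ B9Thm313WholeInputZ B9Thm313WholeDirZ B9Thm313WholeDirInputZ B9Thm313WholeDirInputBZ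
open B9Thm313WholeL2GZ B9Thm313WholeL2GPZ B9Thm313WholeDirL2Z B9Thm313WholeLeafCompletePairMBZ
open B6KLevelCensusIndexV1 (KIdx)
open B9GeoNormsKLevelV1 (geo9K)
open B9CoRealizesRelAtLetters (RelB maj342_relB_left maj342_relB_right dist_eq_of_relB relB_refl)
open B9GeoLemma21KLevelV1 (rowSum261_geo9K geo9K_one_le_L geo9K_eta_pos)
open B9GeoNormsKLevelModelSignsV1 (modelSignsOn_geo9K)
open Summit.QuantumFields.YangMills.Theorems.Prop7SectET3Members (hd3)
open Summit.QuantumFields.YangMills.Theorems.Prop7SectET3Geometry (geoOK_geo9K geo9K_L_le lemma21AboveG_geo9K)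
open Summit.QuantumFields.YangMills.Theorems.Prop7SectET3BgClass (bgT3)
open Summit.QuantumFields.YangMills.Theorems.Prop7SectET3Letters (LettersRowZT3)
open Summit.QuantumFields.YangMills.Theorems.Prop7SectET3N06LeavesRelZ (card_filter_relB_le)
open Summit.QuantumFields.YangMills.Theorems.Prop7SectET3Floor (thm313Printed_of_floor hnbr_geo9K_floor hCL_geo9K_floor)

variable {ℓ : ℕ} {hL : Odd (ℓ + 1) ∧ 1 < ℓ + 1} {b₀ b₁ : ℝ} {c35 : ℝ}

/-- ★★★ **THEOREM 3.13 AS THE WHOLE PRINTED LEAF — THE SPECIES OF RECORD (`thm313Printed_completePairMBZ`: residual ABSORBED, Z-classed letters, carrier-relative co-readings) — READ AT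
THE T³ INDEX.**  At `I := KIdx 2 ℓ hd3 hL b₀ b₁`, `geo := geo9K`, `bg := bgT3`, `R₀ ≡ 1`, relation `RelB` («same carrier block», multiplicity `m = 6`), cutting constant `C_L = Lc = ℓ + 1`:
DISPLAYED VERBATIM (over the full T³ index): the letter records `𝔬`, probes `𝔭`, Hölder block norms `bH ∕ bHX ∕ bHW`, direction letters `Dd ∕ Dds` (pair type `P`), the co-readings
`hcoR hco1R hcoG hl2N hH1N hIF`, the symmetry `hsymGG`, the model hypotheses `hmodel` (Thm 3.3 for `G₀` = THE XL ITEM, Steps, FormSmall, Identities), `hleft`, the Z-classed letters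
**`hletters := LettersRowZT3 𝔬 1 H₀ wZ hwZ c35 a₁ M₁ B₃ δ₃`** + `hlettersD` (`Letters313DZ ∧ Letters313DMZ`), the direction-indexed G₀ rows `hG0C`, the steps `hstepD` (`StepDirB`) ∕ `hstepL2`,
the H-letters `hLHH` (`LettersHHZ`) ∕ `hLH3` (`Letters313HZ`), `hG0L2` (`Thm33G0L2M`), the L² letters `hLL2` (`Letters313L2PZ ∧ Letters313L2MZ`, weights `vZ`), the input letters `hLIM`
(`Letters313IMB` — carrying Track A's located `locX` defect `B9Letters313IMBLocObstruction`, displayed as at the record), the numerics with their signs ∕ rate relations.  DISCHARGED HERE: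
`GeoOK`, model signs, `1 ≤ L ≤ ℓ+1`, `0 < η`, the row sum (2.61) at `σ > 0`, `Lemma21AboveG` at the exponent `α ∈ (0,1)`, **the neighbour count `hnbr` and the length comparison `hCL`
ABOVE A FLOOR** (`Prop7SectET3Floor.hnbr_geo9K_floor ∕ hCL_geo9K_floor` on the subtype `{i // M⋆ ≤ M}`, `M⋆ := max M_nbr (r + 1)`, then `thm313Printed_of_floor`), `RelB`'s saturation ∕
multiplicity ∕ distance rows (`maj342_relB_left∕right`, `card_filter_relB_le`, `dist_eq_of_relB`).  Conclusion: `B9.Thm313Printed c35 geo9K bgT3 GG HasRWExp PosDefK` — NO residual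
`hres`: (3.42)–(3.47) of 𝔊 ALL derived from the displayed letters, exactly as OWNER RULING g25-№2's text of record reads.  Nothing of print asserted; NOT a discharge of N06(d = 3).
[cite: Balaban1985BackgroundPropagators, Thm 3.13 p.426, Thm 3.12 p.423, (3.39)-(3.47) pp.397-398, (3.126) p.420, (3.132) p.422, (3.147)-(3.153) pp.425-426; Balaban1984PropagatorsII, (2.3) p.224, (2.45)-(2.46) p.231, (2.51)-(2.52) p.232, Lemma 2.1 (2.59)-(2.61) pp.233-234] -/
theorem t313_of_pins_T3_completePairMBZ [∀ i : KIdx 2 ℓ hd3 hL b₀ b₁, Fintype (geo9K i).Site] [∀ i : KIdx 2 ℓ hd3 hL b₀ b₁, DecidableEq (geo9K i).Site]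
    {X Y Z W PX PY : KIdx 2 ℓ hd3 hL b₀ b₁ → Type} {P : Type} [∀ i, Fintype (X i)] [∀ i, DecidableEq (X i)] [∀ i, Fintype (Y i)]
    [∀ i, Fintype (Z i)] [∀ i, Fintype (W i)] [∀ i, Fintype (PX i)] [∀ i, Fintype (PY i)] [Fintype P]
    (𝔬 : ∀ i : KIdx 2 ℓ hd3 hL b₀ b₁, Ops (geo9K i) (bgT3 i) (X i) (Y i) (Z i) (W i)) (H₀ : KIdx 2 ℓ hd3 hL b₀ b₁ → Prop)
    (GG : ∀ i : KIdx 2 ℓ hd3 hL b₀ b₁, B9.KernelFamily (geo9K i) (bgT3 i)) (bH : ∀ i : KIdx 2 ℓ hd3 hL b₀ b₁, BlockNorm (toB6 (geo9K i) 1 (H₀ i)) (W i → ℝ))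
    (𝔭 : ∀ i : KIdx 2 ℓ hd3 hL b₀ b₁, HolderProbes (geo9K i) (bgT3 i) (X i) (Y i) (PX i) (PY i))
    (bHX : ∀ i : KIdx 2 ℓ hd3 hL b₀ b₁, ℝ → BlockNorm (toB6 (geo9K i) 1 (H₀ i)) (X i → ℝ))
    (Dd Dds : ∀ i : KIdx 2 ℓ hd3 hL b₀ b₁, (bgT3 i).Cfg → P → Module.End ℝ (X i → ℝ))
    (bHW : ∀ i : KIdx 2 ℓ hd3 hL b₀ b₁, ℝ → BlockNorm (toB6 (geo9K i) 1 (H₀ i)) (W i → ℝ))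
    (ev : ∀ i : KIdx 2 ℓ hd3 hL b₀ b₁, (geo9K i).Loc → X i → ℝ) (evY : ∀ i : KIdx 2 ℓ hd3 hL b₀ b₁, (geo9K i).Loc → Y i → ℝ)
    (r Cev θ₁ θD θ₂ r₁ B₀ B₂ B₄ δ₀ δK σ ρ a₁ M₁ B₃ δ₃ ρ' α κ₀ : ℝ) (Bh Bi Bq BhD Bx Bd θH θI θV Br : ℝ → ℝ)
    (Bi2 Bd2 : ℝ → ℝ → ℝ)
    (hθ₁ : 0 ≤ θ₁) (hθD : 0 ≤ θD) (hθH : ∀ β, 0 ≤ β → β < 1 → 0 ≤ θH β) (hθI : ∀ ε, 0 < ε → 0 ≤ θI ε) (hθ₂ : 0 ≤ θ₂)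
    (hθV : ∀ ε, 0 < ε → 0 ≤ θV ε) (hr₁ : 0 ≤ r₁) (hB₀ : 0 ≤ B₀) (hB₂ : 0 ≤ B₂)
    (hB₃ : 0 ≤ B₃) (hB₄ : 0 ≤ B₄) (hBr : ∀ ε, 0 < ε → 0 ≤ Br ε) (hσ : 0 < σ) (hρ' : 0 < ρ') (hρ'ρ : ρ' + 3 * σ ≤ ρ) (hρ'ρ₅ : ρ' + 5 * σ ≤ ρ)
    (hσρ' : 3 * σ < (1 - α) * ρ')
    (hρS : ρ ≤ δ₀) (hρ₃ : ρ ≤ δ₃) (hρδ : ρ + σ ≤ δK) (ha₁ : 0 < a₁) (hM₁ : 0 < M₁)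
    (hα0 : 0 < α) (hα1 : α < 1) (hBi : ∀ ε, 0 < ε → ε ≤ 1 → 0 ≤ Bi ε) (hBd : ∀ ε, 0 < ε → ε ≤ 1 → 0 ≤ Bd ε)
    (hBi2 : ∀ ε β, 0 < ε → ε ≤ 1 → 0 ≤ β → β < 1 → 0 ≤ Bi2 ε β) (hBd2 : ∀ ε β, 0 < ε → ε ≤ 1 → 0 ≤ β → β < 1 → 0 ≤ Bd2 ε β)
    (hBh : ∀ β, 0 ≤ β → β < 1 → 0 ≤ Bh β) (hBq : ∀ β, 0 ≤ β → β < 1 → 0 ≤ Bq β) (hBhD : ∀ β, 0 ≤ β → β < 1 → 0 ≤ BhD β)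
    (hBx : ∀ β, 0 ≤ β → β < 1 → 0 ≤ Bx β) (hCev : 0 ≤ Cev)
    (hκ : ∀ i : KIdx 2 ℓ hd3 hL b₀ b₁, (bH i).κ ≤ κ₀)
    (hκW : ∀ (i : KIdx 2 ℓ hd3 hL b₀ b₁) (ε : ℝ), (bHW i ε).κ ≤ κ₀)
    (hcoR : ∀ (i : KIdx 2 ℓ hd3 hL b₀ b₁) (U : (bgT3 i).Cfg),
      CoRealizesRel (GG i) 0 U (RelB i) (𝔬 i).blk (𝔬 i).blk (ev i) ((𝔬 i).GG U) ∧
      CoRealizesRel (GG i) 2 U (RelB i) (𝔬 i).blk (𝔬 i).blkY (evY i) ((𝔬 i).GG U ∘ₗ (𝔬 i).Dstar U))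
    (hco1R : ∀ (i : KIdx 2 ℓ hd3 hL b₀ b₁) (U : (bgT3 i).Cfg), CoRealizesRel (GG i) 1 U (RelB i) (𝔬 i).blkY (𝔬 i).blk (ev i) ((𝔬 i).D U ∘ₗ (𝔬 i).GG U))
    (hcoG : ∀ (i : KIdx 2 ℓ hd3 hL b₀ b₁) (U : (bgT3 i).Cfg),
      CoReadsGlob (GG i) 0 U (𝔬 i).blk (𝔬 i).blk (ev i) ((𝔬 i).GG U) ∧
      CoReadsGlob (GG i) 1 U (𝔬 i).blkY (𝔬 i).blk (ev i) ((𝔬 i).D U ∘ₗ (𝔬 i).GG U) ∧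
      CoReadsGlob (GG i) 2 U (𝔬 i).blk (𝔬 i).blkY (evY i) ((𝔬 i).GG U ∘ₗ (𝔬 i).Dstar U))
    (hsymGG : ∀ i : KIdx 2 ℓ hd3 hL b₀ b₁, M₁ ≤ (geo9K i).M → ∀ α₀ : ℝ, 0 < α₀ → (geo9K i).M * α₀ ≤ a₁ →
      ∀ U : (bgT3 i).Cfg, (bgT3 i).Reg335 c35 α₀ U → (bgT3 i).Reg336 c35 α₀ U →
        IsTransposePair ((𝔬 i).GG U) ((𝔬 i).GG U) ∧ IsTransposePair ((𝔬 i).D U ∘ₗ (𝔬 i).GG U) ((𝔬 i).GG U ∘ₗ (𝔬 i).Dstar U))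
    (hl2N : ∀ (i : KIdx 2 ℓ hd3 hL b₀ b₁) (U : (bgT3 i).Cfg),
      L2ReadsNbr (R := (1 : ℝ)) (H := H₀ i) (GG i) 0 U (RelB i) r Cev (𝔬 i).blk (𝔬 i).blk (ev i) ((𝔬 i).GG U) ∧
      L2ReadsNbr (R := (1 : ℝ)) (H := H₀ i) (GG i) 1 U (RelB i) r Cev (𝔬 i).blkY (𝔬 i).blk (ev i) ((𝔬 i).D U ∘ₗ (𝔬 i).GG U) ∧
      L2ReadsNbr (R := (1 : ℝ)) (H := H₀ i) (GG i) 2 U (RelB i) r Cev (𝔬 i).blk (𝔬 i).blkY (evY i) ((𝔬 i).GG U ∘ₗ (𝔬 i).Dstar U) ∧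
      L2ReadsNbr (R := (1 : ℝ)) (H := H₀ i) (GG i) 3 U (RelB i) r Cev ((𝔬 i).blk ∘ Prod.fst) (𝔬 i).blk (ev i)
        (familyOp (fun q : P × P => Dd i U q.1 ∘ₗ ((𝔬 i).GG U ∘ₗ Dds i U q.2))) ∧
      L2ReadsNbr (R := (1 : ℝ)) (H := H₀ i) (GG i) 4 U (RelB i) r Cev ((𝔬 i).blk ∘ Prod.fst) (𝔬 i).blk (ev i)
        (familyOp (fun q : P × P => (Dd i U q.1 ∘ₗ Dd i U q.2) ∘ₗ (𝔬 i).GG U)) ∧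
      L2ReadsNbr (R := (1 : ℝ)) (H := H₀ i) (GG i) 5 U (RelB i) r Cev ((𝔬 i).blk ∘ Prod.fst) (𝔬 i).blk (ev i)
        (familyOp (fun q : P × P => (𝔬 i).GG U ∘ₗ (Dds i U q.1 ∘ₗ Dds i U q.2))))
    (hH1N : ∀ (i : KIdx 2 ℓ hd3 hL b₀ b₁) (U : (bgT3 i).Cfg),
      H1ReadsNbr (GG i) U (𝔭 i) (RelB i) r (𝔬 i).blk (𝔬 i).blkY (ev i) (evY i) ((𝔬 i).D U ∘ₗ (𝔬 i).GG U)
        ((𝔬 i).GG U ∘ₗ (𝔬 i).Dstar U))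
    (hIF : ∀ (i : KIdx 2 ℓ hd3 hL b₀ b₁) (U : (bgT3 i).Cfg),
      InputReadsFam (GG i) U (bHX i) r ((𝔬 i).blk ∘ Prod.fst) ((𝔭 i).blkPX ∘ Prod.fst) (fun β => sliceProbe ((𝔭 i).ΦX U β)) (ev i)
        (familyOp (fun q : P × P => Dd i U q.1 ∘ₗ ((𝔬 i).GG U ∘ₗ Dds i U q.2))))
    (hmodel : ∀ i : KIdx 2 ℓ hd3 hL b₀ b₁, M₁ ≤ (geo9K i).M → ∀ α₀ : ℝ, 0 < α₀ → (geo9K i).M * α₀ ≤ a₁ →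
      ∀ U : (bgT3 i).Cfg, (bgT3 i).Reg335 c35 α₀ U → (bgT3 i).Reg336 c35 α₀ U →
        Thm33G0 (𝔬 i) 1 (H₀ i) B₀ δ₀ U ∧
        Step (𝔬 i) 1 (H₀ i) (geoOK_geo9K i).lenle 1 (θ₁ * ((geo9K i).M * α₀)) δK U ∧
        Step (𝔬 i) 1 (H₀ i) (geoOK_geo9K i).lenle 2 (θ₁ * ((geo9K i).M * α₀)) δK U ∧
        FormSmall (𝔬 i) (r₁ * ((geo9K i).M * α₀)) U ∧ Identities (𝔬 i) U)
    (hleft : ∀ i : KIdx 2 ℓ hd3 hL b₀ b₁, M₁ ≤ (geo9K i).M → ∀ α₀ : ℝ, 0 < α₀ → (geo9K i).M * α₀ ≤ a₁ →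
      ∀ U : (bgT3 i).Cfg, (bgT3 i).Reg335 c35 α₀ U → (bgT3 i).Reg336 c35 α₀ U →
        LeftStep (𝔬 i) 1 (H₀ i) (geoOK_geo9K i).lenle B₀ δ₀ (θD * ((geo9K i).M * α₀)) δK U)
    (wZ : ∀ i : KIdx 2 ℓ hd3 hL b₀ b₁, (geo9K i).Site → ℝ) (hwZ : ∀ i y, 0 < wZ i y)
    (hletters : LettersRowZT3 𝔬 (fun _ => 1) H₀ wZ hwZ c35 a₁ M₁ B₃ δ₃)
    (hlettersD : ∀ i : KIdx 2 ℓ hd3 hL b₀ b₁, M₁ ≤ (geo9K i).M → ∀ α₀ : ℝ, 0 < α₀ → (geo9K i).M * α₀ ≤ a₁ →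
      ∀ U : (bgT3 i).Cfg, (bgT3 i).Reg335 c35 α₀ U → (bgT3 i).Reg336 c35 α₀ U →
        Letters313DZ (𝔬 i) 1 (H₀ i) (geoOK_geo9K i) (wZ i) (hwZ i) B₃ δ₃ (bH i) U ∧
          Letters313DMZ (𝔬 i) (𝔭 i) (Dd i) 1 (H₀ i) (geoOK_geo9K i) (wZ i) (hwZ i) B₃ Bq δ₃ (bH i) U)
    (hG0C : ∀ i : KIdx 2 ℓ hd3 hL b₀ b₁, M₁ ≤ (geo9K i).M → ∀ α₀ : ℝ, 0 < α₀ → (geo9K i).M * α₀ ≤ a₁ →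
      ∀ U : (bgT3 i).Cfg, (bgT3 i).Reg335 c35 α₀ U → (bgT3 i).Reg336 c35 α₀ U →
        Thm33G0Dir (𝔬 i) (𝔭 i) (Dd i) (Dds i) 1 (H₀ i) (bHX i) B₀ Bh Bi Bi2 δ₀ U ∧
          Thm33G0DirR (𝔬 i) (Dds i) 1 (H₀ i) B₀ δ₀ U)
    (hstepD : ∀ i : KIdx 2 ℓ hd3 hL b₀ b₁, M₁ ≤ (geo9K i).M → ∀ α₀ : ℝ, 0 < α₀ → (geo9K i).M * α₀ ≤ a₁ →
      ∀ U : (bgT3 i).Cfg, (bgT3 i).Reg335 c35 α₀ U → (bgT3 i).Reg336 c35 α₀ U →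
        StepDirB (𝔬 i) (𝔭 i) (Dd i) (Dds i) 1 (H₀ i) (bHX i) (geoOK_geo9K i).lenle (θD * ((geo9K i).M * α₀))
          (fun β => θH β * ((geo9K i).M * α₀)) (fun ε => θI ε * ((geo9K i).M * α₀)) δK U)
    (hLHH : ∀ i : KIdx 2 ℓ hd3 hL b₀ b₁, M₁ ≤ (geo9K i).M → ∀ α₀ : ℝ, 0 < α₀ → (geo9K i).M * α₀ ≤ a₁ →
      ∀ U : (bgT3 i).Cfg, (bgT3 i).Reg335 c35 α₀ U → (bgT3 i).Reg336 c35 α₀ U →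
        LettersHHZ (𝔬 i) (𝔭 i) 1 (H₀ i) (geoOK_geo9K i).lenle
          (weightNorm (BlockNorm.ofBlocks (toB6 (geo9K i) 1 (H₀ i)) (𝔬 i).blkZ) (wZ i) fun y => (hwZ i y).le) Bq δ₃ U)
    (hLH3 : ∀ i : KIdx 2 ℓ hd3 hL b₀ b₁, M₁ ≤ (geo9K i).M → ∀ α₀ : ℝ, 0 < α₀ → (geo9K i).M * α₀ ≤ a₁ →
      ∀ U : (bgT3 i).Cfg, (bgT3 i).Reg335 c35 α₀ U → (bgT3 i).Reg336 c35 α₀ U →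
        Letters313HZ (𝔬 i) (𝔭 i) 1 (H₀ i) (geoOK_geo9K i) (wZ i) (hwZ i) (bH i) BhD Bx δ₃ U)
    (hG0L2 : ∀ i : KIdx 2 ℓ hd3 hL b₀ b₁, M₁ ≤ (geo9K i).M → ∀ α₀ : ℝ, 0 < α₀ → (geo9K i).M * α₀ ≤ a₁ →
      ∀ U : (bgT3 i).Cfg, (bgT3 i).Reg335 c35 α₀ U → (bgT3 i).Reg336 c35 α₀ U →
        Thm33G0L2M (𝔬 i) (Dd i) (Dds i) 1 (H₀ i) B₂ δ₀ U)
    (hstepL2 : ∀ i : KIdx 2 ℓ hd3 hL b₀ b₁, M₁ ≤ (geo9K i).M → ∀ α₀ : ℝ, 0 < α₀ → (geo9K i).M * α₀ ≤ a₁ →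
      ∀ U : (bgT3 i).Cfg, (bgT3 i).Reg335 c35 α₀ U → (bgT3 i).Reg336 c35 α₀ U →
        StepL2 (𝔬 i) 1 (H₀ i) (θ₂ * ((geo9K i).M * α₀)) δK U)
    (vZ : ∀ i : KIdx 2 ℓ hd3 hL b₀ b₁, (geo9K i).Site → ℝ) (hvZ : ∀ i y, 0 < vZ i y)
    (hLL2 : ∀ i : KIdx 2 ℓ hd3 hL b₀ b₁, M₁ ≤ (geo9K i).M → ∀ α₀ : ℝ, 0 < α₀ → (geo9K i).M * α₀ ≤ a₁ →
      ∀ U : (bgT3 i).Cfg, (bgT3 i).Reg335 c35 α₀ U → (bgT3 i).Reg336 c35 α₀ U →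
        Letters313L2PZ (𝔬 i) (Dd i) (Dds i) 1 (H₀ i) B₄ δ₃ (vZ i) (hvZ i) U ∧
          Letters313L2MZ (𝔬 i) (Dd i) (Dds i) 1 (H₀ i) B₄ δ₃ (vZ i) (hvZ i) U)
    (hLIM : ∀ i : KIdx 2 ℓ hd3 hL b₀ b₁, M₁ ≤ (geo9K i).M → ∀ α₀ : ℝ, 0 < α₀ → (geo9K i).M * α₀ ≤ a₁ →
      ∀ U : (bgT3 i).Cfg, (bgT3 i).Reg335 c35 α₀ U → (bgT3 i).Reg336 c35 α₀ U →
        Letters313IMB (𝔬 i) (𝔭 i) (Dd i) (Dds i) 1 (H₀ i) (geoOK_geo9K i).lenle (bHX i) (bHW i) Br (fun ε => θV ε * ((geo9K i).M * α₀))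
          Bd Bd2 δ₃ δK U)
    (HasRWExp : ∀ i : KIdx 2 ℓ hd3 hL b₀ b₁, B9.KernelFamily (geo9K i) (bgT3 i) → (bgT3 i).Cfg → ℝ → Prop)
    (PosDefK : ∀ i : KIdx 2 ℓ hd3 hL b₀ b₁, B9.KernelFamily (geo9K i) (bgT3 i) → (bgT3 i).Cfg → Prop)
    (hpinE : ∀ i : KIdx 2 ℓ hd3 hL b₀ b₁, HasRWExp i = HasRWExpOfOps (𝔬 i)) (hpinK : ∀ i : KIdx 2 ℓ hd3 hL b₀ b₁, PosDefK i = PosDefKOfOps (𝔬 i)) :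
    B9.Thm313Printed c35 geo9K bgT3 GG HasRWExp PosDefK := by
  classical
  have hE : HasRWExp = fun i => HasRWExpOfOps (𝔬 i) := funext hpinE
  have hK : PosDefK = fun i => PosDefKOfOps (𝔬 i) := funext hpinK
  rw [hE, hK]
  -- the floor: neighbour counts need `M ≥ M_nbr`, the length comparison needs `r < M`
  obtain ⟨Mnbr, mN, hnbrF⟩ := hnbr_geo9K_floor (ℓ := ℓ) (hL := hL) (b₀ := b₀) (b₁ := b₁) r
  set Mstar : ℝ := max Mnbr (r + 1) with hMstar
  have hrM : r < Mstar := lt_of_lt_of_le (lt_add_one r) (le_max_right _ _)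
  let Sub : Type := {i : KIdx 2 ℓ hd3 hL b₀ b₁ // Mstar ≤ (geo9K i).M}
  have hnbrSub : ∀ (j : Sub) (y : (geo9K j.1).Site), (nbr (geo9K j.1) r y).card ≤ mN :=
    fun j y => hnbrF ⟨j.1, (le_max_left _ _).trans j.2⟩ y
  -- the generic row sum (2.61) at rate `σ`, Lemma 2.1 above threshold at exponent `α`, both restricted to the floor subtype
  obtain ⟨ML, c, hrow⟩ := rowSum261_geo9K (d := 2) (ℓ := ℓ) (hd := hd3) (hL := hL) (b₀ := b₀) (b₁ := b₁) σ hσ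
  have hL21sub : ∀ δ : ℝ, 0 < δ → ∃ ML' c' : ℝ, Lemma21AboveG (fun j : Sub => geo9K j.1) (fun _ => (1 : ℝ)) (fun j => H₀ j.1) δ α ML' c' := by
    intro δ hδ
    obtain ⟨ML', c', h⟩ := lemma21AboveG_geo9K (d := 2) (ℓ := ℓ) (hd := hd3) (hL := hL) (b₀ := b₀) (b₁ := b₁) H₀ hα0 hα1 δ hδ
    exact ⟨ML', c', fun j hM => h j.1 hM⟩
  have hL1c : 1 ≤ (((ℓ + 1 : ℕ) : ℝ)) := by exact_mod_cast Nat.succ_le_succ (Nat.zero_le ℓ)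
  refine thm313Printed_of_floor (geo := geo9K) (bg := bgT3) Mstar ?_
  exact thm313Printed_completePairMBZ (geo := fun j : Sub => geo9K j.1) (bg := fun j : Sub => bgT3 j.1)
      (fun j => 𝔬 j.1) (fun _ => 1) (fun j => H₀ j.1) (fun j => GG j.1) (fun j => bH j.1) (fun j => 𝔭 j.1) (fun j => bHX j.1) (fun j => Dd j.1) (fun j => Dds j.1)
      (fun j => bHW j.1) (fun j => ev j.1) (fun j => evY j.1) (fun j => RelB j.1) (2 * (2 + 1)) mN
      r Cev (((ℓ + 1 : ℕ) : ℝ)) θ₁ θD θ₂ r₁ B₀ B₂ B₄ δ₀ δK σ (max c 0) ρ a₁ M₁ ML B₃ δ₃ ρ' α (((ℓ + 1 : ℕ) : ℝ)) κ₀ Bh Bi Bq BhD Bx Bd θH θI θV Br Bi2 Bd2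
      hθ₁ hθD hθH hθI hθ₂ hθV hr₁ hB₀ hB₂ hB₃ hB₄ hBr hσ.le hρ' hρ'ρ hρ'ρ₅ hσρ' hρS hρ₃ hρδ (le_max_right _ _) ha₁ hM₁ hα0.le hBi hBd hBi2 hBd2 hBh hBq hBhD hBx hCev
      hL1c (fun j => geoOK_geo9K j.1) (fun j => modelSignsOn_geo9K j.1) (fun j => geo9K_one_le_L j.1) (fun j => geo9K_L_le j.1) (fun j => geo9K_eta_pos j.1)
      (fun j => hκ j.1) (fun j ε => hκW j.1 ε) (fun j hM y => (hrow j.1 hM y).trans (le_max_left _ _)) hL21sub hnbrSub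
      (fun j a a' h => hCL_geo9K_floor hrM j a a' h)
      (fun j n B' δ' => ⟨fun a a' b h => maj342_relB_left j.1 n B' δ' a a' b h, fun a b b' h => maj342_relB_right j.1 n B' δ' a b b' h⟩)
      (fun j y' => card_filter_relB_le j.1 y') (fun j U => hcoR j.1 U) (fun j U => hco1R j.1 U) (fun j U => hcoG j.1 U)
      (fun j hM α₀ hα₀ hMa U hU hU' => hsymGG j.1 hM α₀ hα₀ hMa U hU hU') (fun j U => hl2N j.1 U) (fun j U => hH1N j.1 U) (fun j U => hIF j.1 U)
      (fun j a a' b h => dist_eq_of_relB j.1 h (relB_refl j.1 b))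
      (fun j hM α₀ hα₀ hMa U hU hU' => hmodel j.1 hM α₀ hα₀ hMa U hU hU') (fun j hM α₀ hα₀ hMa U hU hU' => hleft j.1 hM α₀ hα₀ hMa U hU hU')
      (fun j => wZ j.1) (fun j y => hwZ j.1 y) (fun j hM α₀ hα₀ hMa U hU hU' => hletters j.1 hM α₀ hα₀ hMa U hU hU')
      (fun j hM α₀ hα₀ hMa U hU hU' => hlettersD j.1 hM α₀ hα₀ hMa U hU hU') (fun j hM α₀ hα₀ hMa U hU hU' => hG0C j.1 hM α₀ hα₀ hMa U hU hU')
      (fun j hM α₀ hα₀ hMa U hU hU' => hstepD j.1 hM α₀ hα₀ hMa U hU hU') (fun j hM α₀ hα₀ hMa U hU hU' => hLHH j.1 hM α₀ hα₀ hMa U hU hU')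
      (fun j hM α₀ hα₀ hMa U hU hU' => hLH3 j.1 hM α₀ hα₀ hMa U hU hU') (fun j hM α₀ hα₀ hMa U hU hU' => hG0L2 j.1 hM α₀ hα₀ hMa U hU hU')
      (fun j hM α₀ hα₀ hMa U hU hU' => hstepL2 j.1 hM α₀ hα₀ hMa U hU hU') (fun j => vZ j.1) (fun j y => hvZ j.1 y)
      (fun j hM α₀ hα₀ hMa U hU hU' => hLL2 j.1 hM α₀ hα₀ hMa U hU hU') (fun j hM α₀ hα₀ hMa U hU hU' => hLIM j.1 hM α₀ hα₀ hMa U hU hU')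

end Summit.QuantumFields.YangMills.Theorems.Prop7SectET3N06LeavesRecord

end
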